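import Literature.AnabelianGeometry.AbsoluteAnabelian.AbsTopII.TwoTripodNodalProp13viii
import Literature.AnabelianGeometry.AbsoluteAnabelian.AbsTopII.Prop13vCoveringReduction
import Mathlib.GroupTheory.SpecificGroups.Cyclic
import HarnessLib

/-!
# [AbsTopII] Prop 1.3 (viii) at the two-vertex nodal datum, IV: the centraliser of ANY non-trivial inertia element (KeyGen)

S. Mochizuki, *Topics in Absolute Anabelian Geometry II* [AbsTopII] (bib `MochizukiAbsTopII2013`; locators =
PDF pages of the kurims manuscript `paper:url-585b8d0ad0d9`), §1 Prop 1.3 (iv)/(v)/(viii) pp. 11–12 (proof p. 13: the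
inertia group `I_v ≅ Ẑ^Σ` acts on the pro-`Σ` trees of the coverings with fixed locus the vertex `v`); Lyndon–Schupp
Ch. II §3 (Fox calculus) [cite: LyndonSchupp2001, Ch. II §3].

PROOF-ONLY companion of `AbsTopII/TwoTripodNodalDatum.lean` (abc-iut-f-066 gen 6, follow-on «P13viii-TWO-VERTEX»), part
IV.  It DISCHARGES the one named input «KeyGen» of part III (`prop_1_3_viii'_dpsc_of_keyGen`):

> **KeyGen.** `g ∈ Π_𝔾`, `s ∈ I_{v_A} = T` (resp. `I_{v_B} = U`), `s ≠ 1`, `g s = s g`  ⟹  `g ∈ Π_{v_A}` (resp. `Π_{v_B}`)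

— for EVERY non-trivial `s`, not only for the powers `t₀ⁿ` of the topological generator (abc-iut-f-066 KEY₂, p482872):
when `|Σ| ≥ 2` a non-trivial element of `T ≅ Ẑ^Σ` may generate a NON-open closed subgroup.  ROUTE: the Fox-calculus
shadow of Bass–Serre of p482872, with two changes.  (1) For `s' = s^r` acting trivially on the finite quotient
`G = P/V`, write `s' = z·υ` with `z ∈ closure⟨ι(b₀b₁)⟩ ⊆ Π_𝔾` and `υ` centralising `ι(b₂)` (from `T ⊆ Π_e·U`,
`U ⊆ Π_e·T`); then `conj(s')` is the identity on `ι(b₀), ι(b₁)` and `conj(z)` on `ι(b₂)`, and `ψ(z) = (w1·w2)^M` for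
some `M ∈ ℕ`, so `ψ ∘ conj(s') = thetaConj_M ∘ ψ`.  (2) The coefficient ring is `ZMod m` where `m` is the index of
an open normal subgroup `O` of `T` missing `χ(z)`, `χ : P → T` a continuous character with `χ(ι b₀) = t₀`,
`χ(ι b₁) = χ(ι b₂) = 1`; the exponent-sum character `ε₁ : W3 → ZMod m` (`w1 ↦ 1`, `w2, w3 ↦ 0`) satisfies
`ε₁ ∘ ψ = λ ∘ χ` on `Π_𝔾` (`λ : T → T/O ≅ ZMod m`, `zmodMulEquivOfGenerator`), whence
`(M : ZMod m) = ε₁(ψ z) = λ(χ z) ≠ 0` — the division-free coset-sum test (p480813) applies.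

* `exists_character_T` — a continuous character `T → ZMod m` (`m` a `Σ`-number) separating a given `e ≠ 1`, with
  `t₀ ↦ 1`; `exists_expSum_hom` — the exponent-sum character `ε₁` of the Fox group `W3`;
* `mem_closure_of_commute_gen` — **KeyGen, abstract form** over a free basis `(b₀, b₁, b₂)`, an element `s` fixing
  `ι(b₀), ι(b₁)`, a character `χ : P → T` and section decompositions `sⁿ = z·υ` with `χ(z) ≠ 1`.
Part V (`TwoTripodNodalProp13viiiHolds.lean`) instantiates it at `T` and `U` and concludes the typed `Prop_1_3_viii'`
with NO hypothesis.
HONEST FRAMING: classical profinite group theory (pro-`Σ` completions of free groups, finite quotients, Fox calculus)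
under OUR kernel check, at a constructed model (constructed ≠ geometric); consistency evidence for typed rows, not a
discharge at geometric data; nothing here bears on [IUTchIII] Cor 3.12; no side taken.
-/

noncomputable section

open scoped Pointwise

namespace Literature.AnabelianGeometry.AbsoluteAnabelian.AbsTopII.TwoTripodNodal.Model

open Literature.AnabelianGeometry.SemiGraphs
open Literature.AnabelianGeometry.SemiGraphs.SemiGraphOfAnabelioids (IsProSigmaCompletion)
open Literature.AnabelianGeometry.SemiGraphs.SemiGraphOfAnabelioids.IsProSigmaCompletion
open Literature.AnabelianGeometry.Anabelioids (IsSigmaInteger)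
open Literature.GroupTheory.CombinatorialGroupTheory
open Literature.GroupTheory.CombinatorialGroupTheory.PuncturedSurfaceGroup
open Literature.GroupTheory.CombinatorialGroupTheory.FreeFactorFibredTwist (lift_apply_basis)
open Literature.GroupTheory.CombinatorialGroupTheory.FoxChain
open _root_.Topology

variable {Sigma : Set ℕ} (M : Model Sigma)

/-! ### The Fox target over a general `Σ`-number of coefficients -/

/-- Powers of `Σ`-integers are `Σ`-integers. [cite: MochizukiSemiAnbd2006, Def. 2.9(i) p.31] -/
theorem isSigmaInteger_pow {m : ℕ} (hm : IsSigmaInteger Sigma m) (a : ℕ) : IsSigmaInteger Sigma (m ^ a) := by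
  induction a with
  | zero => rw [pow_zero]; exact IsSigmaInteger.one Sigma
  | succ a ih => rw [pow_succ]; exact ih.mul hm

/-- For a `Σ`-integer `m` and a finite group `G` of `Σ`-integer order, every subgroup of `W3 G (ZMod m)` has
`Σ`-integer index. [cite: MochizukiSemiAnbd2006, Def. 2.9(i) p.31] -/
theorem isSigmaInteger_index_W3' {m : ℕ} (hm : IsSigmaInteger Sigma m) (G : Type) [Group G] [Finite G]
    (hG : IsSigmaInteger Sigma (Nat.card G)) (V : Subgroup (W3 G (ZMod m))) : IsSigmaInteger Sigma V.index := by
  haveI : NeZero m := ⟨hm.1.ne'⟩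
  haveI : Finite (W3 G (ZMod m)) :=
    Finite.of_injective (fun w : W3 G (ZMod m) => (w.left, w.right))
      (fun w w' h => SemidirectProduct.ext (congrArg Prod.fst h) (congrArg Prod.snd h))
  refine IsSigmaInteger.of_dvd ?_ V.index_dvd_card
  rw [natCard_W3]
  exact (((isSigmaInteger_pow hm _).mul ((isSigmaInteger_pow hm _).mul (isSigmaInteger_pow hm _)))).mul hG

/-- The coefficient sum over the whole group is invariant under left translation. [cite: LyndonSchupp2001, Ch. II §3] -/
theorem csum_univ_lt {G : Type*} [Group G] [Fintype G] {k : Type*} [AddCommMonoid k] (g : G) (f : G → k) :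
    csum Finset.univ (lt g f) = csum Finset.univ f := by
  simp only [csum_apply, lt_apply]
  exact Fintype.sum_equiv (Equiv.mulLeft g⁻¹) _ _ fun q => rfl

/-- **The exponent-sum character** `ε₁ : W3 → k`, `((f₁,f₂,f₃), X) ↦ Σ_q f₁(q)` (the image of the Fox chain in
`H₁`: total `a₁`-exponent), as a homomorphism into `Multiplicative k`; `ε₁(w1) = 1`, `ε₁(w2) = ε₁(w3) = 0`.
[cite: LyndonSchupp2001, Ch. II §3] -/
theorem exists_expSum_hom (G : Type) [Group G] [Fintype G] [DecidableEq G] (k : Type) [CommRing k] (A₁ A₂ A₃ : G) :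
    ∃ ε : W3 G k →* Multiplicative k,
      (∀ w, ε w = Multiplicative.ofAdd (csum Finset.univ (Multiplicative.toAdd w.left).1)) ∧
      ε (w1 A₁) = Multiplicative.ofAdd 1 ∧ ε (w2 A₂) = 1 ∧ ε (w3 A₃) = 1 := by
  let ε : W3 G k →* Multiplicative k :=
    { toFun := fun w => Multiplicative.ofAdd (csum Finset.univ (Multiplicative.toAdd w.left).1)
      map_one' := by
        show Multiplicative.ofAdd (csum Finset.univ (0 : V3 G k).1) = 1
        rw [Prod.fst_zero, map_zero]; rfl
      map_mul' := fun w w' => by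
        rw [← ofAdd_add, SemidirectProduct.mul_left, toAdd_mul, toAdd_foxAct3, Prod.fst_add, map_add, csum_univ_lt] }
  refine ⟨ε, fun w => rfl, ?_, ?_, ?_⟩
  · show Multiplicative.ofAdd (csum Finset.univ (Multiplicative.toAdd (w1 A₁ : W3 G k).left).1) = _
    rw [w1]; simp only [toAdd_ofAdd, csum_e, Finset.mem_univ, if_true]
  · show Multiplicative.ofAdd (csum Finset.univ (Multiplicative.toAdd (w2 A₂ : W3 G k).left).1) = _
    rw [w2]; simp only [toAdd_ofAdd, map_zero]; rfl
  · show Multiplicative.ofAdd (csum Finset.univ (Multiplicative.toAdd (w3 A₃ : W3 G k).left).1) = _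
    rw [w3]; simp only [toAdd_ofAdd, map_zero]; rfl

/-! ### The quotient of `T` by an open subgroup is cyclic on the image of `t₀` -/

/-- The pro-`Σ` completion map `ℤ → T`, `1 ↦ t₀`. [cite: MochizukiAbsTopII2013, Prop 1.3 (iii) p.11] -/
theorem exists_kappaT : ∃ κ : Multiplicative ℤ →* ↥M.T, IsProSigmaCompletion Sigma κ ∧
    ((κ (Multiplicative.ofAdd (1 : ℤ)) : M.P) = M.ι (SemidirectProduct.inr (Multiplicative.ofAdd (1 : ℤ)))) :=
  ⟨((Subgroup.inclusion (Subgroup.le_topologicalClosure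
      ((SemidirectProduct.inr : Multiplicative ℤ →* PuncturedSurfaceGroup 0 4 ⋊[M.φ] Multiplicative ℤ).range.map M.ι))).comp
      (M.ι.subgroupMap (SemidirectProduct.inr : Multiplicative ℤ →* PuncturedSurfaceGroup 0 4 ⋊[M.φ] Multiplicative ℤ).range)).comp
      (MonoidHom.ofInjective (SemidirectProduct.inr_injective (φ := M.φ))).toMonoidHom,
    SemidirectCofinal.isProSigmaCompletion_closure_inr M.φ M.isProSigmaCompletion, rfl⟩

/-- **A character of `T` separating a given non-trivial element**: for `e ∈ T`, `e ≠ 1`, there are a `Σ`-number `m`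
and a continuous `λ : T → ZMod m` (discrete) with `λ(t₀) = 1` and `λ(e) ≠ 0` (an open normal subgroup `O ∌ e`; `T/O`
is cyclic on the image of `t₀`; `zmodMulEquivOfGenerator`). [cite: MochizukiAbsTopII2013, Prop 1.3 (iii) p.11] -/
theorem exists_character_T {e : ↥M.T} (he : e ≠ 1) :
    ∃ (m : ℕ) (_ : IsSigmaInteger Sigma m) (lam : ↥M.T →* Multiplicative (ZMod m)),
      (∀ tT : TopologicalSpace (Multiplicative (ZMod m)), tT = ⊥ → Continuous lam) ∧
      lam ⟨M.ι (SemidirectProduct.inr (Multiplicative.ofAdd (1 : ℤ))), M.t0_mem_T⟩ = Multiplicative.ofAdd 1 ∧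
      lam e ≠ 1 := by
  haveI : CompactSpace ↥M.T := isCompact_iff_compactSpace.mp (Subgroup.isClosed_topologicalClosure _).isCompact
  obtain ⟨κ, hκ, hκ1⟩ := M.exists_kappaT
  set t₀ : ↥M.T := ⟨M.ι (SemidirectProduct.inr (Multiplicative.ofAdd (1 : ℤ))), M.t0_mem_T⟩ with ht₀
  have hκt : κ (Multiplicative.ofAdd (1 : ℤ)) = t₀ := Subtype.ext hκ1
  -- an open normal subgroup missing `e`
  obtain ⟨O, hO⟩ := ProfiniteGrp.exist_openNormalSubgroup_sub_open_nhds_of_one (isOpen_compl_singleton (x := e))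
    (by rw [Set.mem_compl_singleton_iff]; exact fun h => he h.symm)
  have heO : e ∉ O := fun h => hO h rfl
  set m : ℕ := O.toSubgroup.index with hm_def
  have hm : IsSigmaInteger Sigma m := hκ.index_open O.toSubgroup O.isNormal' O.isOpen'
  -- `T / O` is cyclic, generated by the image of `t₀`
  haveI : O.toSubgroup.Normal := O.isNormal'
  let πO : ↥M.T →* ↥M.T ⧸ O.toSubgroup := QuotientGroup.mk' O.toSubgroup
  have hgen : ∀ x : ↥M.T ⧸ O.toSubgroup, x ∈ Subgroup.zpowers (πO t₀) := by
    let Hq : Subgroup ↥M.T := (Subgroup.zpowers (πO t₀)).comap πO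
    have hHo : IsOpen (Hq : Set ↥M.T) := by
      change IsOpen (πO ⁻¹' ((Subgroup.zpowers (πO t₀) : Subgroup (↥M.T ⧸ O.toSubgroup)) : Set _))
      exact (isOpen_discrete _).preimage QuotientGroup.continuous_mk
    have hHc : IsClosed (Hq : Set ↥M.T) := Subgroup.isClosed_of_isOpen _ hHo
    have hrange : Set.range κ ⊆ Hq := by
      rintro _ ⟨n, rfl⟩
      have hn : κ n = t₀ ^ Multiplicative.toAdd n := by
        rw [← hκt, ← map_zpow, ← ofAdd_zsmul, smul_eq_mul, mul_one, ofAdd_toAdd]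
      show πO (κ n) ∈ Subgroup.zpowers (πO t₀)
      rw [hn, map_zpow]
      exact Subgroup.zpow_mem _ (Subgroup.mem_zpowers _) _
    have htop : (Hq : Set ↥M.T) = Set.univ := by
      apply Set.eq_univ_of_univ_subset
      rw [← hκ.dense.closure_eq]
      exact closure_minimal hrange hHc
    intro x
    obtain ⟨y, rfl⟩ := QuotientGroup.mk_surjective x
    have hy : y ∈ Hq := by rw [← SetLike.mem_coe, htop]; exact Set.mem_univ y
    exact hy
  have hcard : Nat.card (↥M.T ⧸ O.toSubgroup) = m := rfl
  let eqv := zmodMulEquivOfGenerator hgen hcard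
  let lam : ↥M.T →* Multiplicative (ZMod m) := eqv.symm.toMonoidHom.comp πO
  refine ⟨m, hm, lam, fun tT htT => ?_, ?_, ?_⟩
  · subst htT
    haveI : DiscreteTopology (Multiplicative (ZMod m)) := ⟨rfl⟩
    have h1 : Continuous (fun q : ↥M.T ⧸ O.toSubgroup => eqv.symm q) := continuous_of_discreteTopology
    have h2 : Continuous (fun x : ↥M.T => πO x) := QuotientGroup.continuous_mk
    exact h1.comp h2
  · show eqv.symm (πO t₀) = Multiplicative.ofAdd 1
    exact zmodMulEquivOfGenerator_symm_apply_generator hgen hcard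
  · show eqv.symm (πO e) ≠ 1
    intro h
    have h1 : πO e = 1 := by
      rw [← eqv.apply_symm_apply (πO e), h, map_one]
    exact heO ((QuotientGroup.eq_one_iff e).mp h1)


/-! ### KeyGen, finite quotient by finite quotient -/

section Key

variable (b : FreeGroupBasis (Fin 3) (PuncturedSurfaceGroup 0 4)) {s : M.P}

/-- **KeyGen, finite-quotient form.**  Data: a free basis `(b₀,b₁,b₂)` of `Γ_{0,4}`; `s ∈ P` fixing `ι(b₀)`, `ι(b₁)`
under conjugation; a continuous character `χ : P → T` with `χ(ι b₀) = t₀`, `χ(ι b₁) = χ(ι b₂) = 1`; and for every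
power `sⁿ` (`n ≥ 1`) a decomposition `sⁿ = z·υ` with `z ∈ closure⟨κG(b₀b₁)⟩`, `υ` centralising `ι(b₂)` and `χ(z) ≠ 1`.
Then an element `g ∈ Π_𝔾` commuting with `s` lies in `closure ι⟨b₀,b₁⟩ · V` for every open normal `V ≤ P`.
[cite: MochizukiAbsTopII2013, Prop 1.3 (viii) p.12] -/
theorem exists_mem_closure_inv_mul_mem_gen
    (hs0 : s * M.ι (SemidirectProduct.inl (b 0)) * s⁻¹ = M.ι (SemidirectProduct.inl (b 0)))
    (hs1 : s * M.ι (SemidirectProduct.inl (b 1)) * s⁻¹ = M.ι (SemidirectProduct.inl (b 1)))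
    (χ : M.P →* ↥M.T) (hχc : Continuous χ)
    (hχ0 : χ (M.ι (SemidirectProduct.inl (b 0))) =
      ⟨M.ι (SemidirectProduct.inr (Multiplicative.ofAdd (1 : ℤ))), M.t0_mem_T⟩)
    (hχ1 : χ (M.ι (SemidirectProduct.inl (b 1))) = 1) (hχ2 : χ (M.ι (SemidirectProduct.inl (b 2))) = 1)
    (hdec : ∀ n : ℕ, 0 < n → ∃ z₀ ∈ (Subgroup.zpowers (M.κG (b 0 * b 1))).topologicalClosure, ∃ υ : M.P,
      υ * M.ι (SemidirectProduct.inl (b 2)) * υ⁻¹ = M.ι (SemidirectProduct.inl (b 2)) ∧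
        s ^ n = (z₀ : M.P) * υ ∧ χ (z₀ : M.P) ≠ 1)
    {g : M.P} (hg : g ∈ M.PiG) (hcomm : g * s = s * g) (V : OpenNormalSubgroup M.P) :
    ∃ p ∈ ((Subgroup.closure ({b 0, b 1} : Set (PuncturedSurfaceGroup 0 4))).map
        (M.ι.comp SemidirectProduct.inl)).topologicalClosure, p⁻¹ * g ∈ V := by
  classical
  haveI hN : M.PiG.Normal := M.normal_PiG
  haveI : CompactSpace ↥M.PiG := isCompact_iff_compactSpace.mp M.isClosed_PiG.isCompact
  -- the finite quotient `G = P / V`, a `Σ`-group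
  letI : Fintype (M.P ⧸ V.toSubgroup) := Fintype.ofFinite _
  set π : M.P →* M.P ⧸ V.toSubgroup := QuotientGroup.mk' V.toSubgroup with hπ
  have hGsig : IsSigmaInteger Sigma (Nat.card (M.P ⧸ V.toSubgroup)) :=
    M.isProSigmaCompletion.index_open V.toSubgroup V.isNormal' V.isOpen'
  set A₀ := π (M.ι (SemidirectProduct.inl (b 0))) with hA₀
  set A₁ := π (M.ι (SemidirectProduct.inl (b 1))) with hA₁
  set A₂ := π (M.ι (SemidirectProduct.inl (b 2))) with hA₂
  -- `s' = s^r` is trivial in `G` and commutes with `g`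
  set r : ℕ := orderOf (π s) with hr_def
  have hr : 0 < r := orderOf_pos _
  have hπr : π (s ^ r) = 1 := by rw [map_pow, hr_def, pow_orderOf_eq_one]
  have hgr : g * s ^ r = s ^ r * g := by
    have hc : Commute g s := hcomm
    exact hc.pow_right r
  obtain ⟨z₀, hz₀, υ, hυ, hsdec, hχz⟩ := hdec r hr
  have hz₀G : (z₀ : M.P) ∈ M.PiG := z₀.2
  -- `conj(s^r)` on the basis: fixes `ι(b₀)`, `ι(b₁)`, conjugates `ι(b₂)` by `z₀`
  have hc0 := M.pow_mul_mul_pow_inv_of_fixed hs0 r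
  have hc1 := M.pow_mul_mul_pow_inv_of_fixed hs1 r
  have hc2 : s ^ r * M.ι (SemidirectProduct.inl (b 2)) * (s ^ r)⁻¹ =
      (z₀ : M.P) * M.ι (SemidirectProduct.inl (b 2)) * (z₀ : M.P)⁻¹ := by
    rw [hsdec, mul_inv_rev]
    calc (z₀ : M.P) * υ * M.ι (SemidirectProduct.inl (b 2)) * (υ⁻¹ * (z₀ : M.P)⁻¹)
        = (z₀ : M.P) * (υ * M.ι (SemidirectProduct.inl (b 2)) * υ⁻¹) * (z₀ : M.P)⁻¹ := by group
      _ = (z₀ : M.P) * M.ι (SemidirectProduct.inl (b 2)) * (z₀ : M.P)⁻¹ := by rw [hυ]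
  -- the coefficient character of `T` separating `χ(z₀)`
  obtain ⟨m, hm, lam, hlamc, hlam0, hlamz⟩ := M.exists_character_T hχz
  haveI : NeZero m := ⟨hm.1.ne'⟩
  letI : TopologicalSpace (Multiplicative (ZMod m)) := ⊥
  haveI : DiscreteTopology (Multiplicative (ZMod m)) := ⟨rfl⟩
  have hlamc' : Continuous lam := hlamc _ rfl
  -- the Fox group over `G` with coefficients `ZMod m` and the continuous Fox homomorphism `ψ`
  letI : TopologicalSpace (W3 (M.P ⧸ V.toSubgroup) (ZMod m)) := ⊥
  haveI : DiscreteTopology (W3 (M.P ⧸ V.toSubgroup) (ZMod m)) := ⟨rfl⟩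
  haveI : Finite (W3 (M.P ⧸ V.toSubgroup) (ZMod m)) :=
    Finite.of_injective (fun w : W3 (M.P ⧸ V.toSubgroup) (ZMod m) => (w.left, w.right))
      (fun w w' h => SemidirectProduct.ext (congrArg Prod.fst h) (congrArg Prod.snd h))
  let ψ₀ : PuncturedSurfaceGroup 0 4 →* W3 (M.P ⧸ V.toSubgroup) (ZMod m) := b.lift ![w1 A₀, w2 A₁, w3 A₂]
  have hψ₀b : ∀ j, ψ₀ (b j) = ![w1 A₀, w2 A₁, w3 A₂] j := fun j => lift_apply_basis b _ j
  obtain ⟨ψ, hψc, hψ⟩ := exists_continuous_extend_profinite M.isProSigmaCompletion_κG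
    (fun V' _ _ => isSigmaInteger_index_W3' hm (M.P ⧸ V.toSubgroup) hGsig V') ψ₀
  have hψb0 : ψ (M.κG (b 0)) = w1 A₀ := by rw [hψ, hψ₀b]; rfl
  have hψb1 : ψ (M.κG (b 1)) = w2 A₁ := by rw [hψ, hψ₀b]; rfl
  have hψb2 : ψ (M.κG (b 2)) = w3 A₂ := by rw [hψ, hψ₀b]; rfl
  have hrc : Continuous (SemidirectProduct.rightHom :
      W3 (M.P ⧸ V.toSubgroup) (ZMod m) → M.P ⧸ V.toSubgroup) := continuous_of_discreteTopology
  -- (i) the `G`-component of `ψ` is `π`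
  have hright : ∀ x : ↥M.PiG, (ψ x).right = π (x : M.P) := by
    have h := continuous_extend_profinite_unique M.isProSigmaCompletion_κG
      (F := (SemidirectProduct.rightHom (N := Multiplicative (V3 (M.P ⧸ V.toSubgroup) (ZMod m)))
        (G := M.P ⧸ V.toSubgroup) (φ := foxAct3)).comp ψ)
      (F' := π.comp M.PiG.subtype) (hrc.comp hψc)
      (QuotientGroup.continuous_mk.comp continuous_subtype_val) fun γ => by
        have hγ : (π.comp M.PiG.subtype) (M.κG γ) = π (M.ι (SemidirectProduct.inl γ)) := rfl
        rw [hγ, MonoidHom.comp_apply, hψ]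
        have hb : (SemidirectProduct.rightHom.comp ψ₀) = π.comp (M.ι.comp SemidirectProduct.inl) := by
          refine b.ext_hom _ _ fun j => ?_
          rw [MonoidHom.comp_apply, hψ₀b]
          fin_cases j <;> rfl
        exact DFunLike.congr_fun hb γ
    intro x
    exact DFunLike.congr_fun h x
  -- (ii) every `ψ x` is a path chain
  have hpath : ∀ x : ↥M.PiG, ψ x ∈ pathSub3 A₀ A₁ A₂ := by
    let D : Subgroup ↥M.PiG := (pathSub3 A₀ A₁ A₂).comap ψ
    have hDc : IsClosed (D : Set ↥M.PiG) := by
      change IsClosed (ψ ⁻¹' ((pathSub3 A₀ A₁ A₂ : Subgroup (W3 (M.P ⧸ V.toSubgroup) (ZMod m))) : Set _))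
      exact (isClosed_discrete _).preimage hψc
    have hD : ∀ j, M.κG (b j) ∈ D := by
      intro j
      show ψ (M.κG (b j)) ∈ pathSub3 A₀ A₁ A₂
      fin_cases j
      · exact hψb0 ▸ w1_mem_pathSub3 A₀ A₁ A₂
      · exact hψb1 ▸ w2_mem_pathSub3 A₀ A₁ A₂
      · exact hψb2 ▸ w3_mem_pathSub3 A₀ A₁ A₂
    have hDtop := M.subgroup_eq_top_of_isClosed_of_basis_mem b D hDc hD
    intro x
    have hx : x ∈ D := hDtop ▸ Subgroup.mem_top x
    exact hx
  -- `ψ(z₀)` is a power of `w1·w2`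
  have hzψ : ψ z₀ ∈ Subgroup.zpowers (w1 A₀ * w2 A₁ : W3 (M.P ⧸ V.toSubgroup) (ZMod m)) := by
    let D : Subgroup ↥M.PiG := (Subgroup.zpowers (w1 A₀ * w2 A₁ : W3 (M.P ⧸ V.toSubgroup) (ZMod m))).comap ψ
    have hDc : IsClosed (D : Set ↥M.PiG) := by
      change IsClosed (ψ ⁻¹' ((Subgroup.zpowers (w1 A₀ * w2 A₁) : Subgroup (W3 (M.P ⧸ V.toSubgroup) (ZMod m))) : Set _))
      exact (isClosed_discrete _).preimage hψc
    have hle : Subgroup.zpowers (M.κG (b 0 * b 1)) ≤ D := by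
      rw [Subgroup.zpowers_le]
      show ψ (M.κG (b 0 * b 1)) ∈ Subgroup.zpowers (w1 A₀ * w2 A₁)
      rw [map_mul, map_mul, hψb0, hψb1]
      exact Subgroup.mem_zpowers _
    exact (Subgroup.topologicalClosure_minimal _ hle hDc) hz₀
  obtain ⟨Mx, hMx⟩ : ∃ Mx : ℕ, (w1 A₀ * w2 A₁ : W3 (M.P ⧸ V.toSubgroup) (ZMod m)) ^ Mx = ψ z₀ :=
    (Submonoid.mem_powers_iff _ _).mp ((mem_powers_iff_mem_zpowers).mpr hzψ)
  -- `(A₀A₁)^M` commutes with `A₂` in `G`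
  have hπz : π (z₀ : M.P) = (A₀ * A₁) ^ Mx := by
    have h1 := hright z₀
    rw [← h1, ← hMx]
    show ((w1 A₀ * w2 A₁ : W3 (M.P ⧸ V.toSubgroup) (ZMod m)) ^ Mx).right = (A₀ * A₁) ^ Mx
    rw [← SemidirectProduct.rightHom_eq_right, map_pow, map_mul]
    rfl
  have hcommG : (A₀ * A₁) ^ Mx * A₂ = A₂ * (A₀ * A₁) ^ Mx := by
    have h := congrArg π hc2
    rw [map_mul, map_mul, map_inv, hπr, inv_one, one_mul, mul_one, map_mul, map_mul, map_inv, hπz] at h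
    rw [eq_mul_inv_iff_mul_eq] at h
    exact h.symm
  -- the exponent-sum character: `(M : ZMod m) = ε₁(ψ z₀) = λ(χ z₀) ≠ 0`
  obtain ⟨ε, hε, hε1, hε2, hε3⟩ := exists_expSum_hom (M.P ⧸ V.toSubgroup) (ZMod m) A₀ A₁ A₂
  have hεc : Continuous ε := continuous_of_discreteTopology
  have hεψ : ∀ x : ↥M.PiG, ε (ψ x) = lam (χ (x : M.P)) := by
    have h := continuous_extend_profinite_unique M.isProSigmaCompletion_κG (F := ε.comp ψ)
      (F' := lam.comp (χ.comp M.PiG.subtype)) (hεc.comp hψc)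
      (hlamc'.comp (hχc.comp continuous_subtype_val)) fun γ => by
        have hb : (ε.comp ψ₀) = lam.comp (χ.comp (M.ι.comp SemidirectProduct.inl)) := by
          refine b.ext_hom _ _ fun j => ?_
          simp only [MonoidHom.comp_apply, hψ₀b]
          fin_cases j
          · show ε (w1 A₀) = lam (χ (M.ι (SemidirectProduct.inl (b 0))))
            rw [hε1, hχ0, hlam0]
          · show ε (w2 A₁) = lam (χ (M.ι (SemidirectProduct.inl (b 1))))
            rw [hε2, hχ1, map_one]
          · show ε (w3 A₂) = lam (χ (M.ι (SemidirectProduct.inl (b 2))))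
            rw [hε3, hχ2, map_one]
        show ε (ψ (M.κG γ)) = lam (χ (M.ι (SemidirectProduct.inl γ)))
        rw [hψ]
        exact DFunLike.congr_fun hb γ
    exact fun x => DFunLike.congr_fun h x
  have hMne : (Mx : ZMod m) ≠ 0 := by
    intro h0
    have h1 : ε (ψ z₀) = 1 := by
      rw [← hMx, map_pow, map_mul, hε1, hε2, mul_one, ← ofAdd_nsmul, nsmul_eq_mul, mul_one, h0]; rfl
    rw [hεψ] at h1
    exact hlamz h1
  -- (iii) `ψ ∘ conj(s^r) = Θ ∘ ψ` on `Π_𝔾`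
  set σ : ↥M.PiG →* ↥M.PiG := (MulAut.conjNormal (s ^ r) : MulAut ↥M.PiG).toMonoidHom with hσ_def
  have hσv : ∀ x : ↥M.PiG, ((σ x : ↥M.PiG) : M.P) = s ^ r * x * (s ^ r)⁻¹ := fun x => MulAut.conjNormal_apply _ _
  have hσc : Continuous σ := by
    refine continuous_induced_rng.mpr ?_
    have : (Subtype.val ∘ σ : ↥M.PiG → M.P) = fun x : ↥M.PiG => s ^ r * (x : M.P) * (s ^ r)⁻¹ := funext hσv
    rw [this]
    exact (continuous_const.mul continuous_subtype_val).mul continuous_const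
  have hΘc : Continuous (thetaConj A₀ A₁ A₂ Mx :
      W3 (M.P ⧸ V.toSubgroup) (ZMod m) → W3 (M.P ⧸ V.toSubgroup) (ZMod m)) := continuous_of_discreteTopology
  have hσ0 : σ (M.κG (b 0)) = M.κG (b 0) := Subtype.ext (by rw [hσv, coe_κG]; exact hc0)
  have hσ1 : σ (M.κG (b 1)) = M.κG (b 1) := Subtype.ext (by rw [hσv, coe_κG]; exact hc1)
  have hσ2 : σ (M.κG (b 2)) = z₀ * M.κG (b 2) * z₀⁻¹ := Subtype.ext (by
    rw [hσv, coe_κG, Subgroup.coe_mul, Subgroup.coe_mul, Subgroup.coe_inv, coe_κG]; exact hc2)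
  have hΘ : ∀ x : ↥M.PiG, ψ (σ x) = thetaConj A₀ A₁ A₂ Mx (ψ x) := by
    have h := continuous_extend_profinite_unique M.isProSigmaCompletion_κG (F := ψ.comp σ)
      (F' := (thetaConj A₀ A₁ A₂ Mx).comp ψ) (hψc.comp hσc) (hΘc.comp hψc) fun γ => by
        have hb : (ψ.comp σ).comp M.κG = ((thetaConj A₀ A₁ A₂ Mx).comp ψ).comp M.κG := by
          refine b.ext_hom _ _ fun j => ?_
          simp only [MonoidHom.comp_apply]
          fin_cases j
          · show ψ (σ (M.κG (b 0))) = thetaConj A₀ A₁ A₂ Mx (ψ (M.κG (b 0)))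
            rw [hσ0, hψb0, thetaConj_w1]
          · show ψ (σ (M.κG (b 1))) = thetaConj A₀ A₁ A₂ Mx (ψ (M.κG (b 1)))
            rw [hσ1, hψb1, thetaConj_w2]
          · show ψ (σ (M.κG (b 2))) = thetaConj A₀ A₁ A₂ Mx (ψ (M.κG (b 2)))
            rw [hσ2, map_mul, map_mul, map_inv, hψb2, ← hMx, thetaConj_w3 A₀ A₁ A₂ Mx hcommG]
        exact DFunLike.congr_fun hb γ
    exact fun x => DFunLike.congr_fun h x
  -- (iv) `g` is fixed by `conj(s^r)`: `D(f₃) = 0`, and the division-free coset-sum test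
  set x : ↥M.PiG := ⟨g, hg⟩ with hx_def
  have hσx : σ x = x := by
    apply Subtype.ext
    rw [hσv]
    change s ^ r * g * (s ^ r)⁻¹ = g
    rw [← hgr, mul_inv_cancel_right]
  have hfixW : thetaConj A₀ A₁ A₂ Mx (ψ x) = ψ x := by rw [← hΘ, hσx]
  have hD := dConj_eq_zero_of_thetaConj_eq A₀ A₁ A₂ Mx (ψ x) hfixW
  rw [dConj_def] at hD
  have hE : rt A₀ (Multiplicative.toAdd (ψ x).left).1 - (Multiplicative.toAdd (ψ x).left).1 +
      (rt A₁ (Multiplicative.toAdd (ψ x).left).2.1 - (Multiplicative.toAdd (ψ x).left).2.1) +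
      (rt A₂ (Multiplicative.toAdd (ψ x).left).2.2 - (Multiplicative.toAdd (ψ x).left).2.2) = e (π g) - e 1 := by
    have h := hpath x
    rw [mem_pathSub3_iff, hright x] at h
    exact h
  set Acl : Subgroup M.P := ((Subgroup.closure ({b 0, b 1} : Set (PuncturedSurfaceGroup 0 4))).map
    (M.ι.comp SemidirectProduct.inl)).topologicalClosure with hAcl
  let Hq : Subgroup (M.P ⧸ V.toSubgroup) := Acl.map π
  have hmemA : ∀ d ∈ ({b 0, b 1} : Set (PuncturedSurfaceGroup 0 4)), M.ι (SemidirectProduct.inl d) ∈ Acl :=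
    fun d hd => Subgroup.le_topologicalClosure _ ⟨d, Subgroup.subset_closure hd, rfl⟩
  have hA₀H : A₀ ∈ Hq := Subgroup.mem_map_of_mem π (hmemA _ (Or.inl rfl))
  have hA₁H : A₁ ∈ Hq := Subgroup.mem_map_of_mem π (hmemA _ (Or.inr rfl))
  have hX : π g ∈ Hq := mem_of_fox_chain₃ Hq hA₀H hA₁H hMne hE hD
  obtain ⟨p, hp, hpx⟩ := Subgroup.mem_map.mp hX
  exact ⟨p, hp, QuotientGroup.eq.mp hpx⟩

/-- **KeyGen, abstract form** (finite-quotient form + `⋂_V A·V = A` for the compact `A = closure ι⟨b₀,b₁⟩`).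
[cite: MochizukiAbsTopII2013, Prop 1.3 (viii) p.12] -/
theorem mem_closure_of_commute_gen
    (hs0 : s * M.ι (SemidirectProduct.inl (b 0)) * s⁻¹ = M.ι (SemidirectProduct.inl (b 0)))
    (hs1 : s * M.ι (SemidirectProduct.inl (b 1)) * s⁻¹ = M.ι (SemidirectProduct.inl (b 1)))
    (χ : M.P →* ↥M.T) (hχc : Continuous χ)
    (hχ0 : χ (M.ι (SemidirectProduct.inl (b 0))) =
      ⟨M.ι (SemidirectProduct.inr (Multiplicative.ofAdd (1 : ℤ))), M.t0_mem_T⟩)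
    (hχ1 : χ (M.ι (SemidirectProduct.inl (b 1))) = 1) (hχ2 : χ (M.ι (SemidirectProduct.inl (b 2))) = 1)
    (hdec : ∀ n : ℕ, 0 < n → ∃ z₀ ∈ (Subgroup.zpowers (M.κG (b 0 * b 1))).topologicalClosure, ∃ υ : M.P,
      υ * M.ι (SemidirectProduct.inl (b 2)) * υ⁻¹ = M.ι (SemidirectProduct.inl (b 2)) ∧
        s ^ n = (z₀ : M.P) * υ ∧ χ (z₀ : M.P) ≠ 1)
    {g : M.P} (hg : g ∈ M.PiG) (hcomm : g * s = s * g) :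
    g ∈ ((Subgroup.closure ({b 0, b 1} : Set (PuncturedSurfaceGroup 0 4))).map
        (M.ι.comp SemidirectProduct.inl)).topologicalClosure := by
  set Acl : Subgroup M.P := ((Subgroup.closure ({b 0, b 1} : Set (PuncturedSurfaceGroup 0 4))).map
    (M.ι.comp SemidirectProduct.inl)).topologicalClosure with hAcl
  by_contra hx
  set S : Set M.P := (fun p : M.P => p⁻¹ * g) '' (Acl : Set M.P) with hS_def
  have hcl : IsClosed (Acl : Set M.P) := Subgroup.isClosed_topologicalClosure _
  have hS : IsCompact S := hcl.isCompact.image (continuous_inv.mul continuous_const)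
  have h1S : (1 : M.P) ∈ Sᶜ := by
    rintro ⟨p, hp, hpx⟩
    apply hx
    have h : p = g := inv_mul_eq_one.mp hpx
    rw [← h]
    exact hp
  obtain ⟨V, hV⟩ := ProfiniteGrp.exist_openNormalSubgroup_sub_open_nhds_of_one hS.isClosed.isOpen_compl h1S
  obtain ⟨p, hp, hpV⟩ := M.exists_mem_closure_inv_mul_mem_gen b hs0 hs1 χ hχc hχ0 hχ1 hχ2 hdec hg hcomm V
  exact hV hpV ⟨p, hp, rfl⟩

end Key

end Literature.AnabelianGeometry.AbsoluteAnabelian.AbsTopII.TwoTripodNodal.Model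

end
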